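import Summits.BirchSwinnertonDyer.BirchSwinnertonDyer.Theorems.CongruentShaFreeCutTwoAdicBDPTriple
import Literature.NumberTheory.EllipticCurves.BDPAnticyclotomicPAdicLFunctionUpTo

set_option linter.dupNamespace false
set_option autoImplicit false

/-! # Route `CongruentShaFreeCut` (rung S2) — the BDP triple of crux B (stmt-BirchSwinnertonDyer-19080)
# UP TO NONZERO CONSTANTS: (LB-exist♯) / (LB-wan♯) / (LB-bdp♯) NAMED, and the plumbing, the crux-B census
# and the corank-currency census PORTED to them

Cell `bsd-cn100`, prover seat `bsd-cn100-s2-c3` (g6), executing the plan seat's decision (iii) (plan g13,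
STATUS 2026-08-26T13:33:52Z; memo `HOME/bsd-cn100-plan/routes-g13/DESIGN-LBexist-normalisation-g13.md`;
planner sketch `routes-g13/bc/BDPTripleUpTo_sketch_p2.lean` sha16 cb3cc10da9fe9c6e — the three bodies below
are that sketch's, VERBATIM). Supports, does not close, stmt-BirchSwinnertonDyer-19080. HONEST FRAMING:
three OPEN statements are NAMED (`@[conjecture] def`, nothing asserted) and five CONDITIONAL theorems are
proved over them; nothing here proves crux A, crux B, the leaf `rankOne_twoConverse_congruentNumber`, the
congruent number problem or any case of BSD. PARTITION: none — RANK axis.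

## Why (statement hygiene of the line of record `two-adic-bdp-triple` v5c)

The v5/v5b/v5c statements `CongruentShaFreeCutTwoAdicBDPTriple.{TwoAdicBDPElementExists,
TwoAdicWanDivisibility, TwoAdicBDPValueAtOne}` (p438932) posit Castella's EXACT display
`IsBDPLFunction` (Castella 2018 Thm. 3.1) for `𝓛 ∈ R₀⟦T⟧` at `p = 2`. The printed constant ledger
behind that display (Castella–Hsieh 2018 Prop. 3.4 / 3.6: `2^{#A(ψ)+3} c ε(f) √D_K`, `u_K²`,
`(4π)^{2n+1}(Im ϑ)^{2n}`) consists of `p`-units only for odd `p ∤ c D_K`; at `p = 2` the template gives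
`ord₂ > 0`, so AS TYPED (LB-exist) is plausibly false for a normalisation reason alone, with (LB-wan) /
(LB-bdp) then vacuous. The ♯-statements below replace `IsBDPLFunction …` by `IsBDPLFunctionUpTo C …` with
`C ∈ ℂ₂, C ≠ 0` quantified (∃ in (LB-exist♯), ∀ in (LB-wan♯)/(LB-bdp♯)), and `u ∈ R₀ˣ` in (LB-bdp) by
`u ∈ ℂ₂, u ≠ 0` — the normalisation-INVARIANT content a converse theorem consumes. (LB-exist) ⟹
(LB-exist♯) (`twoAdicBDPElementExistsUpTo_of_exact`); (LB-wan)/(LB-bdp) do NOT cheaply dominate their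
♯-forms (more elements to quantify over), so the ♯ line is PARALLEL to v5c, not a re-cut.

## Contents

§1 the three ♯ statements; §2 sanity; §3 the rank-currency PLUMBING
`heegnerNonTorsion_of_linkA_of_bdpTripleUpTo` (port of the registered plumbing stub p438932: the proof never
unfolds the interpolation property, so it ports verbatim — `⟨…, C, L, hΩ, hC, hL⟩`, `⟨u, hu0, hu⟩`); §4 the
crux-B census `cruxB_of_bdpTripleUpTo_of_poitouTate[_imaginaryQuadratic]` (port of p440516). The
corank-currency plumbing and crux A (ports of p440764) are the sibling
`Theorems/CongruentShaFreeCutBDPTripleUpToCensus.lean` (400-line rule).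

References: [Castella2018] Thm. 2.3, 3.1, 3.4; [CastellaHsieh2018] §3.3, Prop. 3.4, Def. 3.5, Prop. 3.6;
[CastellaGrossiLeeSkinner2022] Thm. 4.2.2, §5.1–5.2, Thm. 5.1.3; [BertoliniDarmonPrasanna2013] Thm. 5.13;
[SilvermanAEC2009] IV.6.4, VII.2.2; [MilneADT2006] I.4.10(b). -/

noncomputable section

open scoped Classical

namespace Summit.BirchSwinnertonDyer.BirchSwinnertonDyer.Theorems.CongruentShaFreeCutTwoAdicBDPTripleUpTo

open PowerSeries WeierstrassCurve NumberField IsDedekindDomain Field Literature.NumberTheory.EllipticCurves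
  Literature.NumberTheory.EllipticCurves.ModularForms Literature.NumberTheory.QuadraticFields
  Literature.NumberTheory.EllipticCurves.Castella2018
open Literature.NumberTheory.GaloisRepresentations Literature.NumberTheory.GaloisCohomology
open Summit.BirchSwinnertonDyer.BirchSwinnertonDyer.Theses.CongruentShaFreeCut
open Summit.BirchSwinnertonDyer.BirchSwinnertonDyer.Theorems.CongruentShaFreeCutTwoAdicLinks
open Summit.BirchSwinnertonDyer.BirchSwinnertonDyer.Theorems.CongruentShaFreeCutTwoAdicBDPTriple
  (TwoAdicBDPElementExists TwoAdicWanDivisibility TwoAdicBDPValueAtOne)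
open Summit.BirchSwinnertonDyer.BirchSwinnertonDyer.Theorems.CongruentShaFreeCutOfHeegnerNonTorsion
  (HeegnerNonTorsionAtTwo analyticRankOne_of_facts_of_heegnerNonTorsion)

/-! ## §1 The three BDP-currency statements UP TO NONZERO CONSTANTS (OPEN; named, nothing asserted;
bodies verbatim from the planner sketch cb3cc10da9fe9c6e) -/

/-- **(LB-exist♯) a `2`-adic anticyclotomic BDP element for `E_n` over a Heegner field with `2` split,
UP TO A NONZERO CONSTANT**: with the data of `TwoAdicBDPElementExists` (square-free `n`, `N = N(E_n)`, `Dt`,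
`K` imaginary quadratic with the Heegner hypothesis for `N` and `2 = v v̄` split, `κ` anticyclotomic with
topological generator `γ`) there are an embedding datum `ι'` inducing `v`, CM periods `Ω_K ≠ 0`,
`Ω_p ∈ R₀ˣ`, a constant `C ∈ ℂ₂, C ≠ 0` and `𝓛 ∈ R₀⟦T⟧` with `IsBDPLFunctionUpTo C ι' v κ γ Dt.f Ω_K Ω_p 𝓛`.
A CONSTRUCTION (open at the additive prime `2`); implied by the exact (LB-exist)
(`twoAdicBDPElementExistsUpTo_of_exact`). [cite: Castella2018, Thm. 3.1 (shape; `p ≥ 5`, `p ∥ N` there)]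
[cite: CastellaHsieh2018, Def. 3.5 and Prop. 3.6 (shape; `p ∤ N` there; the constant `u`)] -/
@[conjecture] def TwoAdicBDPElementExistsUpTo : Prop :=
  ∀ ⦃n : ℕ⦄, Squarefree n →
    ∀ [(congruentNumberCurve n).IsElliptic] [(congruentNumberCurve n).IsGloballyMinimal]
      (K : Type) [Field K] [NumberField K] (N : ℕ) [NeZero N]
      (Dt : ModularParametrizationData (congruentNumberCurve n) N)
      (v : HeightOneSpectrum (𝓞 K)) (κ : ZpExtension K 2) (γ : absoluteGaloisGroup K)
      [Fact (κ.IsTopGenerator γ)],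
    (congruentNumberCurve n).conductorNorm ℤ = N → IsImaginaryQuadratic K →
    SatisfiesHeegnerHypothesis N K → ((Ideal.span {(2 : ℤ)}).primesOver (𝓞 K)).ncard = 2 →
    ((2 : ℕ) : 𝓞 K) ∈ v.asIdeal → κ.IsAnticyclotomic →
    ∃ ι' : PadicAlgCl 2 ≃+* ℂ,
      (∀ (w : InfinitePlace K) (k : 𝓞 K), k ∈ v.asIdeal ↔ ‖ι'.symm (w.embedding (k : K))‖ < 1) ∧
      ∃ (ΩK : ℂ) (Ωp : (unrIntegers 2)ˣ) (C : ℂ_[2]) (L : UnrSeries 2),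
        ΩK ≠ 0 ∧ C ≠ 0 ∧ IsBDPLFunctionUpTo C ι' v κ γ Dt.f ΩK ((Ωp : unrIntegers 2) : ℂ_[2]) L

/-- **(LB-wan♯) the `p`-converse divisibility of the `2`-adic anticyclotomic main conjecture for `E_n`, for
EVERY BDP element UP TO A NONZERO CONSTANT**: with the data of `TwoAdicWanDivisibility`, for every
`(ι', Ω_K, Ω_p, C, 𝓛)` with `Ω_K ≠ 0`, `C ≠ 0`, `IsBDPLFunctionUpTo C …` and every structure map
`j : ℤ₂ → R₀`: `2^k · j_*(char_Λ 𝔛) ⊆ (𝓛)` for some `k`. OPEN at `p = 2` (in print: `p ∤ 2N`).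
[cite: CastellaGrossiLeeSkinner2022, Thm. 4.2.2 and §5.3 (shape of the OTHER divisibility; nothing asserted)]
[cite: Castella2018, Thm. 3.4 (shape; nothing asserted)] -/
@[conjecture] def TwoAdicWanDivisibilityUpTo : Prop :=
  ∀ ⦃n : ℕ⦄, Squarefree n →
    ∀ [(congruentNumberCurve n).IsElliptic] [(congruentNumberCurve n).IsGloballyMinimal]
      (ι' : PadicAlgCl 2 ≃+* ℂ) (K : Type) [Field K] [NumberField K] (N : ℕ) [NeZero N]
      (Dt : ModularParametrizationData (congruentNumberCurve n) N)
      (v vbar : HeightOneSpectrum (𝓞 K)) (κ : ZpExtension K 2) (γ : absoluteGaloisGroup K)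
      [Fact (κ.IsTopGenerator γ)],
    (congruentNumberCurve n).conductorNorm ℤ = N → IsImaginaryQuadratic K →
    SatisfiesHeegnerHypothesis N K → ((Ideal.span {(2 : ℤ)}).primesOver (𝓞 K)).ncard = 2 →
    (∀ (w : InfinitePlace K) (k : 𝓞 K), k ∈ v.asIdeal ↔ ‖ι'.symm (w.embedding (k : K))‖ < 1) →
    ((2 : ℕ) : 𝓞 K) ∈ vbar.asIdeal → vbar ≠ v → κ.IsAnticyclotomic →
    ∀ (ΩK : ℂ) (Ωp : (unrIntegers 2)ˣ) (C : ℂ_[2]) (L : UnrSeries 2),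
      ΩK ≠ 0 → C ≠ 0 → IsBDPLFunctionUpTo C ι' v κ γ Dt.f ΩK ((Ωp : unrIntegers 2) : ℂ_[2]) L →
    ∀ (j : ℤ_[2] →+* unrIntegers 2),
      (∀ x : ℤ_[2], ((j x : unrIntegers 2) : ℂ_[2]) = algebraMap ℚ_[2] ℂ_[2] (x : ℚ_[2])) →
      ∃ k : ℕ, ∀ F ∈ AcSelmer.XAc.charIdeal ((congruentNumberCurve n).baseChange K) 2 κ vbar ∅ γ,
        PowerSeries.C ((2 : unrIntegers 2) ^ k) * PowerSeries.map j F ∈ Ideal.span {L}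

/-- **(LB-bdp♯) the BDP formula at the trivial character for `E_n` at the additive prime `2`, UP TO A
NONZERO CONSTANT of `ℂ₂`, for EVERY BDP element up to a constant**: with the data of `TwoAdicBDPValueAtOne`
(`H`, `w`, `e` inducing `v`, `P` THE Heegner point), for every `(ι', Ω_K, Ω_p, C, 𝓛)` with `Ω_K ≠ 0`,
`C ≠ 0`, `IsBDPLFunctionUpTo C …`: `𝓛(𝟙) = u · c⁻² · (1 − a₂·2⁻¹ + [2 ∤ N]·2⁻¹)² · (log_ω P)²` for some
`u ∈ ℂ₂, u ≠ 0`. OPEN at `p = 2 ∣ N` (in print: `p ∤ 2N`).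
[cite: CastellaGrossiLeeSkinner2022, Thm. 5.1.3 (shape; `p ∤ 2N` there; nothing asserted)]
[cite: BertoliniDarmonPrasanna2013, Thm. 5.13 (shape; nothing asserted)] -/
@[conjecture] def TwoAdicBDPValueAtOneUpTo : Prop :=
  ∀ ⦃n : ℕ⦄, Squarefree n →
    ∀ [(congruentNumberCurve n).IsElliptic] [(congruentNumberCurve n).IsGloballyMinimal]
      (ι' : PadicAlgCl 2 ≃+* ℂ) (K : Type) [Field K] [NumberField K] (N : ℕ) [NeZero N]
      (Dt : ModularParametrizationData (congruentNumberCurve n) N)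
      (H : HeegnerDatum N (NumberField.discr K)) (w : InfinitePlace K) (e : K →+* ℚ_[2])
      (v : HeightOneSpectrum (𝓞 K)) (κ : ZpExtension K 2) (γ : absoluteGaloisGroup K)
      [Fact (κ.IsTopGenerator γ)] (P : ((congruentNumberCurve n).baseChange K).toAffine.Point),
    (congruentNumberCurve n).conductorNorm ℤ = N → IsImaginaryQuadratic K →
    SatisfiesHeegnerHypothesis N K → ((Ideal.span {(2 : ℤ)}).primesOver (𝓞 K)).ncard = 2 →
    ((2 : ℕ) : 𝓞 K) ∈ v.asIdeal →
    (∀ (w' : InfinitePlace K) (k : 𝓞 K), k ∈ v.asIdeal ↔ ‖ι'.symm (w'.embedding (k : K))‖ < 1) →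
    κ.IsAnticyclotomic →
    WeierstrassCurve.Affine.Point.map w.embedding.toRatAlgHom P = heegnerPointComplex Dt H →
    (∀ k : 𝓞 K, k ∈ v.asIdeal ↔ ‖e (k : K)‖ < 1) →
    ∀ (ΩK : ℂ) (Ωp : (unrIntegers 2)ˣ) (C : ℂ_[2]) (L : UnrSeries 2),
      ΩK ≠ 0 → C ≠ 0 → IsBDPLFunctionUpTo C ι' v κ γ Dt.f ΩK ((Ωp : unrIntegers 2) : ℂ_[2]) L →
      ∃ u : ℂ_[2], u ≠ 0 ∧ L.HasValueAt 0
        (u * algebraMap ℚ_[2] ℂ_[2] (((Dt.c : ℚ_[2])⁻¹) ^ 2 *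
            (1 - ((congruentNumberCurve n).LFunction 2 : ℚ_[2]) * (2 : ℚ_[2])⁻¹ +
              (if (2 : ℕ) ∣ N then 0 else (2 : ℚ_[2])⁻¹)) ^ 2 *
            (padicLogOmega (congruentNumberCurve n) 2 e P) ^ 2))

/-! ## §2 Sanity: the exact (LB-exist) implies (LB-exist♯) (with `C = 1`) -/

/-- **(LB-exist) ⟹ (LB-exist♯)**: an exact BDP element is an element up to the constant `C = 1 ≠ 0`
(`IsBDPLFunction.upTo_one`). So the ♯ existence statement is WEAKER than the registered one.
[cite: Castella2018, Thm. 3.1] -/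
theorem twoAdicBDPElementExistsUpTo_of_exact (h : TwoAdicBDPElementExists) :
    TwoAdicBDPElementExistsUpTo := by
  intro n hn _ _ K _ _ N _ Dt v κ γ _ hN hK hH h2 hv hκ
  obtain ⟨ι', hι', ΩK, Ωp, L, hΩ, hL⟩ := h hn K N Dt v κ γ hN hK hH h2 hv hκ
  exact ⟨ι', hι', ΩK, Ωp, 1, L, hΩ, one_ne_zero, hL.upTo_one⟩

/-! ## §3 The rank-currency plumbing, ported (Link A + the ♯ triple ⟹ `HeegnerNonTorsionAtTwo`) -/

/-- **`heegnerNonTorsion_of_linkA_of_bdpTripleUpTo`** — the registered plumbing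
`CongruentShaFreeCutTwoAdicBDPTriple.stub_heegnerNonTorsion_of_linkA_of_bdpTriple` (p438932) with the BDP
triple replaced by its ♯-form: Kato (`hKato`), Link A (`hA`: a generator `F` of `char_Λ 𝔛` with
`F(0) ≠ 0`), (LB-exist♯) (`hE`: `ι'`, `C ≠ 0`, `𝓛`), (LB-wan♯) (`hWan`, along `toUnr : ℤ₂ → R₀`:
`G · 𝓛 = 2^k · toUnr_* F` ⟹ `𝓛(0) ≠ 0`), (LB-bdp♯) (`hV`: `𝓛(0) = u·c⁻²·(…)²·(log_ω P')²`, `u ∈ ℂ₂`)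
give `log_ω P' ≠ 0` for the Galois conjugate `P' = τ_* P` of the Heegner point read through THE infinite
place, hence `P` non-torsion (the logarithm of a torsion point vanishes). The proof is p438932's, token for
token except for the two hypothesis types and the anonymous constructors — the plumbing never unfolds the
interpolation property, so the constant `C` is carried, not used. CONDITIONAL; credits nothing.
[cite: Castella2018, proof of Thm. 2.3 with Thm. 3.4 (the shape of this step)]
[cite: CastellaGrossiLeeSkinner2022, §5.2 (proof of Thm. 5.2.1)] [cite: SilvermanAEC2009, IV.6.4 and VII.2.2] -/
theorem heegnerNonTorsion_of_linkA_of_bdpTripleUpTo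
    (hKato : ∀ (W : WeierstrassCurve ℚ) [W.IsElliptic] (p : ℕ) [Fact p.Prime],
      kato_finite_of_L_one_ne_zero W p)
    (hA : TwoAdicControlOfRankOne) (hE : TwoAdicBDPElementExistsUpTo)
    (hWan : TwoAdicWanDivisibilityUpTo) (hV : TwoAdicBDPValueAtOneUpTo) : HeegnerNonTorsionAtTwo := by
  intro n hsq K _ _ N _ hN hK hHN hH2 hL hrank hsha P hP
  haveI := isElliptic_congruentNumberCurve hsq.ne_zero
  haveI := isGloballyMinimal_congruentNumberCurve hsq
  -- (0) `2 = v v̄` splits in `K`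
  have hsplit : ((Ideal.span {(2 : ℤ)}).primesOver (𝓞 K)).ncard = 2 := by
    simpa using hH2 2 Nat.prime_two (dvd_refl 2)
  -- (1) the rank-one data over `K` (Kato on the twist)
  obtain ⟨hrk, -, hshaK⟩ := AcPConverseLinks.rank_corank_sha_baseChange_of_twist_L_one_ne_zero
    hKato (congruentNumberCurve n) 2 hK hL hrank hsha
  -- (2) the anticyclotomic datum `(κ, γ)`, THE embedding at a degree-one `𝔭 ∋ 2`, `v`, `v̄`
  obtain ⟨κ, γ, 𝔭, hκ, hγ, h𝔭, he, hf⟩ :=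
    Summit.BirchSwinnertonDyer.Rank1Residual.X11b.exists_anticyclotomic_generator_degreeOnePrime
      2 K hK hH2
  haveI : Fact (κ.IsTopGenerator γ) := ⟨hγ⟩
  set ι : K →+* ℚ_[2] := Summit.BirchSwinnertonDyer.Rank1Residual.X11b.embAt K 2 𝔭 h𝔭 he hf
    with hιdef
  set v := Summit.BirchSwinnertonDyer.Rank1Residual.X11b.inducedPlace ι with hvdef
  have hv : ∀ x : 𝓞 K, x ∈ v.asIdeal ↔ ‖ι (x : K)‖ < 1 :=
    Summit.BirchSwinnertonDyer.Rank1Residual.X11b.mem_inducedPlace_iff ι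
  have hv2 : ((2 : ℕ) : 𝓞 K) ∈ v.asIdeal :=
    Summit.BirchSwinnertonDyer.Rank1Residual.X11b.natCast_mem_inducedPlace ι
  obtain ⟨vbar, hvbar, hne⟩ :=
    Summit.BirchSwinnertonDyer.Rank1Residual.X11b.exists_other_prime hH2 v hv2
  -- (3) Link A at this datum: a generator `F` of `char_Λ 𝔛` with `F(0) ≠ 0`
  obtain ⟨m, -, F, hF, hF0, -⟩ :=
    hA hsq K N hN hK hHN hH2 ι v vbar hv hvbar hne κ hκ γ hrk hshaK
  -- (4) the Heegner datum of `P`; the Galois conjugate `P'` read through THE infinite place `w₀`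
  obtain ⟨Dt, H, ιK, hPι⟩ := hP
  obtain ⟨w₀⟩ := (inferInstance : Nonempty (InfinitePlace K))
  haveI : IsGalois ℚ K := by
    haveI : Algebra.IsQuadraticExtension ℚ K := ⟨hK.1⟩
    infer_instance
  obtain ⟨σ, hσ⟩ := ComplexEmbedding.exists_comp_symm_eq_of_comp_eq (k := ℚ) w₀.embedding ιK
    (by ext x; simp)
  set τ : K →+* K := ((σ.symm : K ≃ₐ[ℚ] K) : K →+* K) with hτdef
  set P' := WeierstrassCurve.Affine.Point.map τ.toRatAlgHom P with hP'def
  have hP' : WeierstrassCurve.Affine.Point.map w₀.embedding.toRatAlgHom P' =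
      heegnerPointComplex Dt H := by
    rw [hP'def, WeierstrassCurve.Affine.Point.map_map]
    have hcomp : w₀.embedding.toRatAlgHom.comp τ.toRatAlgHom = ιK.toRatAlgHom := by
      apply AlgHom.ext
      intro x
      have := RingHom.congr_fun hσ x
      simpa [hτdef] using this
    rw [hcomp]
    exact hPι
  -- (5) (LB-exist♯): the BDP element up to the constant `C ≠ 0` at `(Dt, v, κ, γ)`
  obtain ⟨ι', hι', ΩK, Ωp, Cst, L, hΩK, hC, hBDP⟩ := hE hsq K N Dt v κ γ hN hK hHN hsplit hv2 hκ
  -- (6) (LB-wan♯) along the structure map `toUnr : ℤ₂ → R₀` forces `𝓛(0) ≠ 0`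
  obtain ⟨k, hk⟩ := hWan hsq ι' K N Dt v vbar κ γ hN hK hHN hsplit hι' hvbar hne hκ ΩK Ωp Cst L hΩK
    hC hBDP (Summit.BirchSwinnertonDyer.Rank1Residual.X11b.Halves.toUnr 2)
    (Summit.BirchSwinnertonDyer.Rank1Residual.X11b.Halves.coe_toUnr 2)
  have hFmem : F ∈ AcSelmer.XAc.charIdeal ((congruentNumberCurve n).baseChange K) 2 κ vbar ∅ γ := by
    rw [hF]; exact Ideal.mem_span_singleton_self F
  obtain ⟨G, hG⟩ := Ideal.mem_span_singleton'.mp (hk F hFmem)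
  have hL0 : PowerSeries.constantCoeff L ≠ 0 := by
    intro h0
    have h1 := congrArg (fun S : UnrSeries 2 ↦ ((PowerSeries.constantCoeff S : unrIntegers 2) : ℂ_[2])) hG
    simp only [map_mul, h0, mul_zero, PowerSeries.constantCoeff_C,
      Summit.BirchSwinnertonDyer.Rank1Residual.X11b.CongruenceLimit.constantCoeff_map_apply, Subring.coe_mul, Subring.coe_pow, Subring.coe_zero,
      Summit.BirchSwinnertonDyer.Rank1Residual.X11b.Halves.coe_toUnr] at h1
    have h2 : ((2 : unrIntegers 2) : ℂ_[2]) = (2 : ℂ_[2]) := by norm_cast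
    rw [h2] at h1
    have h3 : algebraMap ℚ_[2] ℂ_[2] ((PowerSeries.constantCoeff F : ℤ_[2]) : ℚ_[2]) = 0 := by
      rcases mul_eq_zero.mp h1.symm with h | h
      · exact absurd (pow_eq_zero_iff'.mp h).1 two_ne_zero
      · exact h
    rw [map_eq_zero_iff _ (algebraMap ℚ_[2] ℂ_[2]).injective] at h3
    exact hF0 (PadicInt.coe_eq_zero.mp h3)
  -- (7) (LB-bdp♯) at `P'`: `𝓛(0) = u · c⁻² · (…)² · (log_ω P')²`, so `log_ω P' ≠ 0`
  have hv' : ∀ x : 𝓞 K, x ∈ v.asIdeal ↔ ‖ι (x : K)‖ < 1 := hv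
  obtain ⟨u, -, hu⟩ := hV hsq ι' K N Dt H w₀ ι v κ γ P' hN hK hHN hsplit hv2 hι' hκ hP' hv' ΩK Ωp Cst
    L hΩK hC hBDP
  have hval := UnrSeries.eq_constantCoeff_of_hasValueAt_zero hu
  -- (8) a torsion `P` makes `P'` torsion and `log_ω P' = 0`, contradicting `𝓛(0) ≠ 0`
  intro hPtor
  have hP'tor : IsOfFinAddOrder P' := by
    rw [hP'def]
    exact AddMonoidHom.isOfFinAddOrder _ hPtor
  have hlog : padicLogOmega (congruentNumberCurve n) 2 ι P' = 0 := by
    unfold padicLogOmega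
    rw [AcPConverseLinks.padicLogPoint_formalIndex_smul_eq_zero_of_isOfFinAddOrder
      (congruentNumberCurve n) 2 ι hP'tor, zero_div]
  apply hL0
  rw [hlog, zero_pow two_ne_zero, mul_zero, map_zero, mul_zero] at hval
  exact_mod_cast hval.symm

/-! ## §4 The crux-B census, ported: crux B ⟸ (LB-exist♯) + (LB-wan♯) + (LB-bdp♯) + Poitou–Tate +
six refereed facts -/

/-- **Crux B of S2 from the ♯ triple, modulo Poitou–Tate at imaginary quadratic fields and six refereed
facts** (port of p440516 `cruxB_of_bdpTriple_of_poitouTate_imaginaryQuadratic`): `2`-parity, Modularity,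
Hoffstein–Luo, Kato, Gross 1984, Gross–Zagier + Kolyvagin, Poitou–Tate at every imaginary quadratic field
(`hPT`, the registered `stub_textbookDualityImQuad`), (LB-exist♯), (LB-wan♯), (LB-bdp♯) ⟹
`AnalyticRankOneOfRankOneFiniteShaTwo`: the ported plumbing with Link A :=
`twoAdicControlOfRankOne_of_poitouTate_imaginaryQuadratic hPT` (p432373), then
`analyticRankOne_of_facts_of_heegnerNonTorsion` (p419056). CONDITIONAL; credits nothing.
[cite: MilneADT2006, Ch. I, Thm. 4.10(b) with Cor. 2.3] [cite: GrossZagier1986, Thm. I.6.3 with V.§2]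
[cite: CastellaGrossiLeeSkinner2022, §5.2 (proof of Thm. 5.2.1: the shape of a BDP-type p-converse)] -/
theorem cruxB_of_bdpTripleUpTo_of_poitouTate_imaginaryQuadratic
    (hpar : ∀ (W : WeierstrassCurve ℚ) [W.IsElliptic] (p : ℕ) [Fact p.Prime], p_parity W p)
    (hmod : ModularForms.exists_isNewformOf) (hHL : HoffsteinLuo1997_exists_twist_L_one_ne_zero)
    (hKato : ∀ (W : WeierstrassCurve ℚ) [W.IsElliptic] (p : ℕ) [Fact p.Prime],
      kato_finite_of_L_one_ne_zero W p)
    (hHP : ∀ (W : WeierstrassCurve ℚ) (K : Type) [Field K] [NumberField K],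
      exists_isHeegnerPoint W K)
    (hGZ : ∀ (W : WeierstrassCurve ℚ) (N : ℕ) [NeZero N] (K : Type) [Field K] [NumberField K],
      analyticRankEK_eq_one_iff_heegner_nonTorsion W N K)
    (hPT : ∀ (K : Type) [Field K] [NumberField K], IsImaginaryQuadratic K →
      poitouTate_sum_localTatePairing_eq_zero K)
    (hE : TwoAdicBDPElementExistsUpTo) (hWan : TwoAdicWanDivisibilityUpTo)
    (hV : TwoAdicBDPValueAtOneUpTo) : AnalyticRankOneOfRankOneFiniteShaTwo :=
  analyticRankOne_of_facts_of_heegnerNonTorsion hpar hmod hHL hKato hHP hGZ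
    (heegnerNonTorsion_of_linkA_of_bdpTripleUpTo hKato
      (CongruentShaFreeCutTwoAdicControlOfPoitouTate.twoAdicControlOfRankOne_of_poitouTate_imaginaryQuadratic
        hPT) hE hWan hV)

/-- **Crux B of S2 from the ♯ triple, modulo Poitou–Tate at every number field and six refereed facts**
(port of p440516 `cruxB_of_bdpTriple_of_poitouTate`; the `∀ K` binder shape), by specialisation.
CONDITIONAL; credits nothing. [cite: MilneADT2006, Ch. I, Thm. 4.10(b) with Cor. 2.3]
[cite: GrossZagier1986, Thm. I.6.3 with V.§2] -/
theorem cruxB_of_bdpTripleUpTo_of_poitouTate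
    (hpar : ∀ (W : WeierstrassCurve ℚ) [W.IsElliptic] (p : ℕ) [Fact p.Prime], p_parity W p)
    (hmod : ModularForms.exists_isNewformOf) (hHL : HoffsteinLuo1997_exists_twist_L_one_ne_zero)
    (hKato : ∀ (W : WeierstrassCurve ℚ) [W.IsElliptic] (p : ℕ) [Fact p.Prime],
      kato_finite_of_L_one_ne_zero W p)
    (hHP : ∀ (W : WeierstrassCurve ℚ) (K : Type) [Field K] [NumberField K],
      exists_isHeegnerPoint W K)
    (hGZ : ∀ (W : WeierstrassCurve ℚ) (N : ℕ) [NeZero N] (K : Type) [Field K] [NumberField K],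
      analyticRankEK_eq_one_iff_heegner_nonTorsion W N K)
    (hPT : ∀ (K : Type) [Field K] [NumberField K], poitouTate_sum_localTatePairing_eq_zero K)
    (hE : TwoAdicBDPElementExistsUpTo) (hWan : TwoAdicWanDivisibilityUpTo)
    (hV : TwoAdicBDPValueAtOneUpTo) : AnalyticRankOneOfRankOneFiniteShaTwo :=
  cruxB_of_bdpTripleUpTo_of_poitouTate_imaginaryQuadratic hpar hmod hHL hKato hHP hGZ
    (fun K _ _ _ ↦ hPT K) hE hWan hV

end Summit.BirchSwinnertonDyer.BirchSwinnertonDyer.Theorems.CongruentShaFreeCutTwoAdicBDPTripleUpTo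

end
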